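import Summits.ResolutionOfSingularities.ResolutionOfSingularities.Theorems.EquisingularLiftEquisingularLiftNatStrictTransformFlatRing
import Summits.ResolutionOfSingularities.ResolutionOfSingularities.Theorems.EquisingularLiftEquisingularLiftNatInCarrierStepFlat
import Summits.ResolutionOfSingularities.ResolutionOfSingularities.Theorems.EquisingularLiftCampaignW45bBlowupStalkDictionary
import HarnessLib

/-!
# [OURS · L1 W4.5(b) · EL♮] T-STFLAT-GEN: the strict transform of an `O`-FLAT closed subscheme under ANY blow-up is `O`-flat
# (crux `EquisingularLiftNat` stmt-ResolutionOfSingularities-20038 / child EL♮(3) stmt-20148; line `sections`: every rung step — TC⁺ section steps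
# (`stub_elnat_tcPlusPointResolution`), DIR₀ direction steps (`stub_elnat_dirZeroPointResolution`), TC⁺⁺ cluster steps, nose/curve steps)

NOT a statement of any manuscript. Helper file of the chain res-L1-w45b (cell `res-hironaka`, LADDER-RESOLUTION rung L, slot W4.5(b));
OURS; AI-written, weaker than expert review; `--supports stmt-ResolutionOfSingularities-20038 --as helper` by res-L1-w45b-stub-2 (own object
T-STFLAT-GEN = the structure-free form of the K7b brick …NatInCarrierStepFlat). No `sorry`; standard axioms. It closes nothing by itself.

STATEMENT (`flat_strictTransform_subschemeι_comp`). `O` a DVR, `r : X → Spec O` any morphism, `τ : X′ → X` a blow-up of `X` along ANY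
ideal sheaf `J` (`IsBlowup τ J`; `X`, `X′` locally Noetherian), `C` ANY ideal sheaf on `X` with `V(C) → Spec O` flat. Then
`V(St_τ C) → X′ → X → Spec O` is flat, `St_τ C = strictTransformIdeal τ J C = ⋃ₙ (τ^*C : 𝓘(E)ⁿ)`. No section, separatedness, cone pack,
regularity or integrality is assumed — contrast K7b (`flat_carrierStrictTransform_subschemeι_comp`), which is about the SUP `St 𝓢 ⊔ St K`
of two strict transforms (equal to `St(𝓢 ⊔ K)` only under the carrier cone pack, res-L1-w45b-stub-1 p522194) and therefore keeps its
hypotheses; the assembly below is the same (res-type-100's F3a p512232: flat over the principal ring `Γ(Spec O) ≅ O` = `ϖ`-torsion-free on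
sections, checked on stalks).

WHY TRUE (Stacks 080E + Hartshorne III 9.7): `St_τ V(C) = Bl_{J·𝒪_{V(C)}} V(C)`, and the affine blow-up algebras of a `ϖ`-torsion-free ring
are `ϖ`-torsion-free (sub-rings of localisations). In the tree's currency: at `x′` over `supp J` the stalk `𝒪_{X′,x′}` is a localisation of
a chart algebra `A[J/c_j]` (`A = 𝒪_{X,τ x′}`, res-L1-w45b-stub-2 dictionary `exists_blowupAlgebra_stalk_ringEquiv_of_eq` p506193), the stalk
of `St_τ C` is the saturation `⋃ₙ (C·𝒪 : tⁿ)` (Literature `stalkIdeal_strictTransformIdeal`), and the ring file …NatStrictTransformFlatRing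
(`mem_iSup_colon_of_mul_mem_localization`) shows that `ϖ` stays a nonzerodivisor modulo it once it is one modulo `C_{τ x′}` — which the OLD
flatness gives (`mem_stalkIdeal_of_varpi_mul_mem_of_flat`, …NatInCarrierStepFlat, via res-D-pv-029 p528820). Off `supp J` the blow-up is a
local isomorphism and `St = total transform`; over the generic point `ϖ` is a unit.

* `apply_mem_support_of_mem_support_strictTransformIdeal` — `supp St_τ(C)` lies over `supp C`;
* `mem_stalkIdeal_strictTransform_of_mul_mem` — the stalk statement at every point of the blow-up (chart-algebra presentation), and
  `…_of_not_mem_support` — its elementary form off the centre (local isomorphism; recorded for consumers);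
* **`flat_strictTransform_subschemeι_comp`** (+ `…_stage` in the `(τ ≫ σ) ≫ q` spelling of the rung invariants).

References: R. Hartshorne, *Algebraic Geometry* (1977), III Prop. 9.7 [cite: Hartshorne1977]; The Stacks Project, Tags 080C, 080E, 0804;
U. Görtz, T. Wedhorn, *Algebraic Geometry I* (2020), Prop. 13.91 (3). Tree inputs: p506193, p512232, p528820, Literature MonomialMarkedIdealsBlowup /
BlowupSNC / BlowupsFlatBaseChange / AlterationsSectionDivisor / MarkedIdeals.
-/

set_option linter.dupNamespace false -- mandated namespace `Summit.<Summit>.<Problem>` of this single-conjunct summit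
set_option linter.overlappingInstances false -- signatures carry `[IsDomain O] [IsDiscreteValuationRing O]`

noncomputable section

namespace Summit.ResolutionOfSingularities.ResolutionOfSingularities.Cruxes.EquisingularLiftNat.Sections

open IsLocalRing Literature.AlgebraicGeometry.Resolution

/-! ## Stalk level: the uniformizer is a nonzerodivisor modulo `St_τ(C)` at every point of the blow-up -/

section StalkGen

open CategoryTheory AlgebraicGeometry TopologicalSpace
open Summit.ResolutionOfSingularities.ResolutionOfSingularities.Cruxes.EquisingularLift.StrataSplit

variable {X X' : Scheme.{0}} {τ : X' ⟶ X} {J : X.IdealSheafData}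

/-- The support of a strict transform lies over the support: `x' ∈ supp St_τ(C) ⇒ τ x' ∈ supp C` (`τ^*C ≤ St_τ(C)`). [folklore] -/
theorem apply_mem_support_of_mem_support_strictTransformIdeal (C : X.IdealSheafData) {x' : X'}
    (hx' : x' ∈ ((strictTransformIdeal τ J C).support : Set X')) : τ x' ∈ (C.support : Set X) := by
  have hle : C.comap τ ≤ strictTransformIdeal τ J C := by
    rw [← controlledTransform_zero τ J C]
    exact controlledTransform_le_strictTransformIdeal τ J C 0
  have h := Scheme.IdealSheafData.support_antitone hle hx'
  rw [Scheme.IdealSheafData.support_comap] at h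
  exact h

set_option maxHeartbeats 800000 in -- chart algebra `blowupAlgebra` = subalgebra of a localisation: slow unification (cf. p522194)
/-- **A nonzerodivisor modulo `C_{τ x′}` stays one modulo `St_τ(C)_{x′}`** (at EVERY point `x′` of the blow-up). Blow-up `τ` of `X`
along `J` (`X`, `X′` locally Noetherian), `w ∈ 𝒪_{X,τ x′}` with `w·b ∈ C_{τ x′} ⇒ b ∈ C_{τ x′}`: then `τ^♯(w)·a ∈ St_τ(C)_{x′} ⇒
a ∈ St_τ(C)_{x′}`. In the chart-algebra presentation `𝒪_{X′,x′} ≅ A[J/c_j]_𝔔` (res-L1-w45b-stub-2 dictionary p506193) the stalk of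
`St_τ(C)` is the saturation `⋃ₙ (C·𝒪 : tⁿ)` (Literature `stalkIdeal_strictTransformIdeal`), and the ring file applies.
[cite: Hartshorne1977, III Prop. 9.7 p. 257] [OURS · L1 W4.5b] T-STFLAT-GEN. -/
theorem mem_stalkIdeal_strictTransform_of_mul_mem [IsLocallyNoetherian X] [IsLocallyNoetherian X'] (hτ : IsBlowup τ J)
    (C : X.IdealSheafData) (x' : X') (w : X.presheaf.stalk (τ x'))
    (hw : ∀ b : X.presheaf.stalk (τ x'), w * b ∈ stalkIdeal C (τ x') → b ∈ stalkIdeal C (τ x'))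
    (a : X'.presheaf.stalk x') (ha : (τ.stalkMap x').hom w * a ∈ stalkIdeal (strictTransformIdeal τ J C) x') :
    a ∈ stalkIdeal (strictTransformIdeal τ J C) x' := by
  classical
  -- generators of `J_{τ x'}` and the chart-algebra presentation of the stalk (valid at EVERY point of the blow-up)
  obtain ⟨m, c, hc⟩ := Submodule.fg_iff_exists_fin_generating_family.mp (IsNoetherian.noetherian (stalkIdeal J (τ x')))
  have hcJ : Ideal.span (Set.range c) = stalkIdeal J (τ x') := hc
  obtain ⟨jj, 𝔔, χ, e, hχ, he, -⟩ := exists_blowupAlgebra_stalk_ringEquiv_of_eq hτ x' c (Ideal.span (Set.range c)) rfl hcJ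
  letI := χ.toAlgebra
  haveI : IsLocalization.AtPrime (X'.presheaf.stalk x') 𝔔.asIdeal := isLocalization_stalk_of_ringEquiv 𝔔 x' χ e he
  have hstalkMap : (τ.stalkMap x').hom = χ.comp (algebraMap _ (blowupAlgebra (Ideal.span (Set.range c)) (c jj))) :=
    RingHom.ext fun b => (hχ b).symm
  -- the exceptional stalk is generated by `c_j / 1`
  have hE : stalkIdeal (J.comap τ) x' =
      Ideal.span {χ (algebraMap _ (blowupAlgebra (Ideal.span (Set.range c)) (c jj)) (c jj))} := by
    rw [stalkIdeal_comap_eq_map_stalkMap, ← hcJ, hstalkMap, ← Ideal.map_map,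
      map_blowupAlgebra_eq_span (Ideal.subset_span (Set.mem_range_self jj)), Ideal.map_span, Set.image_singleton]
  -- the stalk of the strict transform is the saturation computed in the stalk
  have hSt : stalkIdeal (strictTransformIdeal τ J C) x' = ⨆ n : ℕ, Submodule.colon
      (((stalkIdeal C (τ x')).map (algebraMap _ (blowupAlgebra (Ideal.span (Set.range c)) (c jj)))).map
        (algebraMap (blowupAlgebra (Ideal.span (Set.range c)) (c jj)) (X'.presheaf.stalk x')))
      ((Ideal.span {algebraMap (blowupAlgebra (Ideal.span (Set.range c)) (c jj)) (X'.presheaf.stalk x')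
        (algebraMap _ (blowupAlgebra (Ideal.span (Set.range c)) (c jj)) (c jj))} ^ n :
          Ideal (X'.presheaf.stalk x')) : Set (X'.presheaf.stalk x')) := by
    rw [stalkIdeal_strictTransformIdeal, hE, hstalkMap, ← Ideal.map_map]
    rfl
  rw [hSt] at ha ⊢
  rw [← hχ w] at ha
  exact mem_iSup_colon_of_mul_mem_localization (Ideal.span (Set.range c)) (c jj) (stalkIdeal C (τ x')) w hw
    𝔔.asIdeal.primeCompl (X'.presheaf.stalk x') a ha

/-- **Off the centre, the elementary way** (not needed for the main theorem, recorded for consumers who avoid chart algebras): at `x′`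
with `τ x′ ∉ supp J` the blow-up is a local isomorphism (`IsBlowup.isIso_compl`) and `St_τ(C)_{x′}` is the total transform
(`stalkIdeal_strictTransformIdeal_of_not_mem_support`), so nonzerodivisors modulo `C_{τ x′}` transport. [cite: GortzWedhorn2020, Prop. 13.91 (3)] -/
theorem mem_stalkIdeal_strictTransform_of_mul_mem_of_not_mem_support [IsLocallyNoetherian X'] (hτ : IsBlowup τ J)
    (C : X.IdealSheafData) (x' : X') (hx' : τ x' ∉ (J.support : Set X)) (w : X.presheaf.stalk (τ x'))
    (hw : ∀ b : X.presheaf.stalk (τ x'), w * b ∈ stalkIdeal C (τ x') → b ∈ stalkIdeal C (τ x'))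
    (a : X'.presheaf.stalk x') (ha : (τ.stalkMap x').hom w * a ∈ stalkIdeal (strictTransformIdeal τ J C) x') :
    a ∈ stalkIdeal (strictTransformIdeal τ J C) x' := by
  rw [stalkIdeal_strictTransformIdeal_of_not_mem_support J C hx'] at ha ⊢
  haveI : IsIso (τ ∣_ ⟨(J.support : Set X)ᶜ, J.support.isClosed.isOpen_compl⟩) := hτ.isIso_compl
  haveI : IsIso (τ.stalkMap x') :=
    isIso_stalkMap_of_isIso_morphismRestrict τ ⟨(J.support : Set X)ᶜ, J.support.isClosed.isOpen_compl⟩ x' hx'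
  have hbij := ConcreteCategory.bijective_of_isIso (τ.stalkMap x')
  obtain ⟨b, rfl⟩ := hbij.2 a
  rw [← map_mul] at ha
  obtain ⟨b', hb', hbb'⟩ := (Ideal.mem_map_iff_of_surjective _ hbij.2).mp ha
  have heq : b' = w * b := hbij.1 hbb'
  rw [heq] at hb'
  exact Ideal.mem_map_of_mem _ (hw b hb')

end StalkGen

/-! ## T-STFLAT-GEN: the strict transform of an `O`-flat closed subscheme under any blow-up is `O`-flat -/

section FlatGen

open CategoryTheory AlgebraicGeometry TopologicalSpace Opposite
open Summit.ResolutionOfSingularities.ResolutionOfSingularities.Cruxes.EquisingularLift.StrataSplit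

/-- **T-STFLAT-GEN — strict transforms of `O`-flat closed subschemes are `O`-flat.** `O` a DVR, `r : X → Spec O`, `τ : X′ → X` a blow-up of
`X` along ANY ideal sheaf `J` (`X`, `X′` locally Noetherian), `C` any ideal sheaf with `V(C) → Spec O` flat. Then
`V(St_τ C) → X′ → X → Spec O` is flat. (Stacks 080E: `St_τ V(C) = Bl_{J|V(C)} V(C)`, and blow-up algebras of a torsion-free ring are
torsion-free; here stalkwise: flat over the principal ring `Γ(Spec O) ≅ O` = `ϖ`-torsion-free on sections = on stalks — a unit over the
generic point, `mem_stalkIdeal_strictTransform_of_mul_mem` over the closed point, fed by the OLD flatness through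
`mem_stalkIdeal_of_varpi_mul_mem_of_flat`; assembly = res-type-100's F3a p512232.) No section, separatedness, cone pack or regularity is
assumed. [cite: Hartshorne1977, III Prop. 9.7 p. 257] [OURS · L1 W4.5b] T-STFLAT-GEN toward every rung of the `sections` line
(`stub_elnat_tcPlusPointResolution`, `stub_elnat_dirZeroPointResolution`, TC⁺⁺); NOT a statement of the manuscript. -/
theorem flat_strictTransform_subschemeι_comp (O : Type) [CommRing O] [IsDomain O] [IsDiscreteValuationRing O]
    {X X' : Scheme.{0}} (r : X ⟶ Spec (.of O)) (τ : X' ⟶ X) (J : X.IdealSheafData) (hτ : IsBlowup τ J)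
    [IsLocallyNoetherian X] [IsLocallyNoetherian X'] (C : X.IdealSheafData) (hflat : Flat (C.subschemeι ≫ r)) :
    Flat ((strictTransformIdeal τ J C).subschemeι ≫ τ ≫ r) := by
  haveI := hflat
  obtain ⟨ϖ, hϖ⟩ := IsDiscreteValuationRing.exists_irreducible O
  -- adapted from `flat_carrierDelta_subschemeι_comp` (…NatCarrierDeltaFlat, res-type-100) / K7b (…NatInCarrierStepFlat)
  set C' := strictTransformIdeal τ J C with hC'
  apply HasRingHomProperty.of_iSup_eq_top (P := @Flat) (fun V : C'.subscheme.affineOpens => V) (iSup_affineOpens_eq_top _)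
  intro V
  letI := ((C'.subschemeι ≫ τ ≫ r).appLE ⊤ (V : C'.subscheme.Opens) le_top).hom.toAlgebra
  change Module.Flat Γ(Spec (.of O), ⊤) Γ(C'.subscheme, V)
  let eR : O ≃+* Γ(Spec (.of O), ⊤) := (Scheme.ΓSpecIso (.of O)).symm.commRingCatIsoToRingEquiv
  haveI : IsDomain Γ(Spec (.of O), ⊤) := MulEquiv.isDomain O eR.symm.toMulEquiv
  haveI : IsPrincipalIdealRing Γ(Spec (.of O), ⊤) := IsPrincipalIdealRing.of_surjective eR.toRingHom eR.surjective
  rw [Module.Flat.flat_iff_torsion_eq_bot_of_isBezout, ← Submodule.isTorsionFree_iff_torsion_eq_bot]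
  refine ⟨fun ρ hρ => ?_⟩
  rw [isSMulRegular_iff_right_eq_zero_of_smul]
  intro μ hμ
  rw [Algebra.smul_def] at hμ
  change ((C'.subschemeι ≫ τ ≫ r).appLE ⊤ _ le_top).hom ρ * μ = 0 at hμ
  have hρ0 : eR.symm ρ ≠ 0 := fun h => hρ.ne_zero (by simpa using congrArg eR h)
  obtain ⟨N, u, hu⟩ := IsDiscreteValuationRing.eq_unit_mul_pow_irreducible hρ0 hϖ
  have hρeq : ρ = eR (u : O) * eR ϖ ^ N := by
    rw [← map_pow, ← map_mul, ← hu, RingEquiv.apply_symm_apply]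
  have heR : ∀ a : O, eR a = (Scheme.ΓSpecIso (.of O)).inv.hom a := fun a => rfl
  -- KEY: `ϖ` is a nonzerodivisor on `Γ(V(St C), V)` — checked on the stalks
  have hw : ∀ μ' : Γ(C'.subscheme, V),
      ((C'.subschemeι ≫ τ ≫ r).appLE ⊤ _ le_top).hom (eR ϖ) * μ' = 0 → μ' = 0 := by
    intro μ' hμ'
    apply TopCat.Presheaf.section_ext C'.subscheme.sheaf _ μ' 0
    intro z hz
    rw [map_zero]
    have hgerm := congrArg (C'.subscheme.presheaf.germ _ z hz).hom hμ'
    rw [map_mul, map_zero, heR, germ_appLE_top, Scheme.Hom.stalkMap_comp, Scheme.Hom.stalkMap_comp] at hgerm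
    change (C'.subschemeι.stalkMap z).hom ((τ.stalkMap _).hom ((r.stalkMap _).hom
      (((Spec (.of O)).presheaf.germ ⊤ _ trivial).hom ((Scheme.ΓSpecIso (.of O)).inv.hom ϖ)))) * _ = 0 at hgerm
    have hx'C : C'.subschemeι z ∈ (C'.support : Set X') := by
      rw [← Scheme.IdealSheafData.range_subschemeι]; exact Set.mem_range_self z
    obtain ⟨a, ha⟩ := C'.subschemeι.stalkMap_surjective z ((C'.subscheme.presheaf.germ _ z hz).hom μ')
    have hker : RingHom.ker (C'.subschemeι.stalkMap z).hom = stalkIdeal C' (C'.subschemeι z) := by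
      rw [← stalkIdeal_ker_eq_ker_stalkMap, Scheme.IdealSheafData.ker_subschemeι]
    by_cases hy : r (τ (C'.subschemeι z)) = IsLocalRing.closedPoint O
    · -- over the closed point: `r^♯` of the germ of `ϖ` is the germ of `r^* ϖ`
      rw [Scheme.Hom.germ_stalkMap_apply] at hgerm
      change (C'.subschemeι.stalkMap z).hom ((τ.stalkMap _).hom
        ((X.presheaf.Γgerm _).hom (r.appTop.hom ((Scheme.ΓSpecIso (.of O)).inv.hom ϖ)))) * _ = 0 at hgerm
      rw [← ha, ← map_mul, ← RingHom.mem_ker, hker] at hgerm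
      suffices key : a ∈ stalkIdeal C' (C'.subschemeι z) by
        change (C'.subscheme.presheaf.germ _ z hz).hom μ' = 0
        rw [← ha]
        rw [← hker, RingHom.mem_ker] at key
        exact key
      -- downstairs: the OLD flatness makes `ϖ` a nonzerodivisor modulo `C_{τ x'}`
      have hysupp : τ (C'.subschemeι z) ∈ (C.support : Set X) := apply_mem_support_of_mem_support_strictTransformIdeal C hx'C
      have hwC := fun b hb => mem_stalkIdeal_of_varpi_mul_mem_of_flat r C _ hysupp hϖ.ne_zero b hb
      exact mem_stalkIdeal_strictTransform_of_mul_mem hτ C _ _ hwC a hgerm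
    · -- over the generic point: `ϖ` is a unit there
      have hunit := ((isUnit_germ_of_ne_closedPoint O _ hy hϖ.ne_zero).map (r.stalkMap _).hom).map
        (τ.stalkMap _).hom |>.map (C'.subschemeι.stalkMap z).hom
      change (C'.subscheme.presheaf.germ _ z hz).hom μ' = 0
      exact (hunit.mul_right_eq_zero).mp hgerm
  -- conclude: `ρ • μ = u ϖⁿ μ = 0 ⇒ μ = 0`
  rw [hρeq, map_mul, map_pow, mul_assoc] at hμ
  have hμ' := ((u.isUnit.map eR).map _).mul_right_eq_zero.mp hμ
  clear hμ hρeq hu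
  induction N generalizing μ with
  | zero => simpa using hμ'
  | succ N ih =>
    rw [pow_succ, mul_assoc] at hμ'
    exact hw μ (ih _ hμ')

/-- **T-STFLAT-GEN in the stage spelling**: base `σ ≫ q`, conclusion for the new stage `(X′, τ ≫ σ)`. -/
theorem flat_strictTransform_subschemeι_comp_stage (O : Type) [CommRing O] [IsDomain O] [IsDiscreteValuationRing O]
    {X X' P : Scheme.{0}} (σ : X ⟶ P) (q : P ⟶ Spec (.of O)) (τ : X' ⟶ X) (J : X.IdealSheafData) (hτ : IsBlowup τ J)
    [IsLocallyNoetherian X] [IsLocallyNoetherian X'] (C : X.IdealSheafData) (hflat : Flat (C.subschemeι ≫ σ ≫ q)) :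
    Flat ((strictTransformIdeal τ J C).subschemeι ≫ (τ ≫ σ) ≫ q) := by
  have h := flat_strictTransform_subschemeι_comp O (σ ≫ q) τ J hτ C hflat
  simpa only [Category.assoc] using h

end FlatGen

end Summit.ResolutionOfSingularities.ResolutionOfSingularities.Cruxes.EquisingularLiftNat.Sections

end
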